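import Summits.RiemannHypothesis.RiemannHypothesis.Theorems.TiltedLandingLaw421R3Lens1Pinning
import Summits.RiemannHypothesis.RiemannHypothesis.Theorems.TiltedLandingLaw421R3RateSkeleton
import Summits.RiemannHypothesis.RiemannHypothesis.Theorems.TiltedLandingLaw421R3TouchedGlueH
import Summits.RiemannHypothesis.RiemannHypothesis.Theses.EarlyAppointments

/-!
# TiltedLandingLaw421R3LooseRecut — the LOOSE class re-cut of ★A's books (lens-2 g8, image 41g; director-rh (CA760)(D); SUPPORT, registry-neutral)

All declarations (K): definitions + proved equivalences / inclusions / compositions over TREE modules only (#1205 `…R3TouchedGlueH`, `…R3Lens1Pinning`,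
`…R3RateSkeleton`).  Nothing here is a registry move: the line of record is `Cruxes/TiltedLandingLaw421R/Lines/trkD_v11q.lean`; the v12q skeleton that
would USE this module is the separate candidate `Cruxes/TiltedLandingLaw421R/Lens2_trkD_v12q_draft.lean` (director + human decision).  The module is useful
under EITHER repair path of (CA757): it prices nothing, it only re-books.

THE RE-CUT IN ONE SENTENCE.  A charged approach level whose lowest pair DISSIPATES `c·s²/η²` of Jensen energy across the level (F1's inequality on the
SAME `(j, j+1)` `lowH` pair under the SAME `Charged (PTrkSQ PBot) StTrkDQ ReadyR2` binder) is paid by the far TELESCOPE from the SAME far purse that ★A's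
allowance already debits — so it can be moved OUT of ★A's class («LOOSE» level) at no capital cost; ★A shrinks to Ac′ = the class law over `Approach ∧ ¬Loose`.

  §L1 `LooseLevelQ c 𝓑` := Approach ∧ ¬𝓑 ∧ (own drop subsidy ≤ the unit charge: `4·dropQ j ≤ s`) ∧ `c·s² ≤ η²·(lowH j² − lowH (j+1)²)`; the excluded
      class `𝓑` is a PARAMETER (instance of record `𝓑 := BetaLevelQ 3`, (CA760)(C); `𝓑 := NoLevelsQ` is the κ₀-free variant, `ac'_antitone`);
      `FarLooseQ c 𝓑 := Far ∨ Loose`; the subsidy clause is AUTOMATIC at a charged level with a non-empty successor band (`subsidy_of_charged_nonempty`).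
  §L2 `EnergyLawOnQ 𝓚 c` (the c-scaled energy law ON A CLASS; `EnergyLawOnQ FarLevelQ c` IS `FarEnergyLawCQ c`, `Iff.rfl`); F1′ :=
      `FarLooseEnergyLawCQ c 𝓑 := EnergyLawOnQ (FarLooseQ c 𝓑) c` and ★ `f1'_iff_f1 : F1′ ↔ FarEnergyLawCQ c` (BOTH directions).
  §L3 the far TELESCOPE `RhW08.SealSwapQ.farLawQ_of_energyLawC_rises` re-proved VERBATIM over an arbitrary class (`classLawQ_of_energyLawOn_rises`; the
      tree theorem is its instance `𝓚 := FarLevelQ`), hence over `Far ∨ Loose` against the SAME purse `c⁻¹·energyPurseQ + c⁻¹·aR`.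
  §L4 Ac′ := `ApproachRecutAllowanceQ c 𝓑 aA := ClassLawQ (Approach ∧ ¬Loose) aA`; ★ `ac'_of_starA : ApproachAllowanceQ aA → Ac′` (a loose level's own
      books summand `1 − 4·dropQ/s` is ≥ 0 by the subsidy clause); `ac'_antitone`.
  §L5 the three books re-cut (`consDiff_farLoose_iff`, `rest_farLoose_iff`), the capital identity at the ½ purse with ★A's allowance literal UNCHANGED
      (`capitalLawPQ_half_recut`), and the door `restRateBotPQ_half_of_recut : F1 → F2 aR → C aC → Ac′(aR, aC) → RestRateBotPQ halfPurse`.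
  §L6 Γ-side glue re-targeted: β law + Γ4′ (`ClassLawQ ((Approach ∧ ¬Loose) ∧ ¬β) aRest`, COUNT-typed) + fit ⟹ Ac′ (`approachRecut_of_TH`, #1205's binders).
  §L7 `law421R_of_recut` : `…Theses.EarlyAppointments.TiltedLandingLaw421R` from TopPinning, RegUmbrella11S, F1, F2c, Cc, Ac′ — generic in `𝓑`
      (a CONDITIONAL composition, like `RhW08.Lens1Coverage.TiltedLandingLaw421R_of_resS`; it credits nothing by itself).

Nothing here bears on the truth of RH; RH is not proved; F1 / F2c / Cc / Ac′ / T★ / Γ3″ / Γ4′ are typed OPEN hypotheses; ★A / 33346 / 33347 OPEN;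
checked ≠ landed ≠ proved.
-/

namespace RhW08.LooseRecut

open RhW08.Round1 RhW08.StSwap RhW08.Round2 RhW08.QuadW
open RhW08.SealSwap (PBot)
open RhW08.SealSwapQ RhW08.RateSplit RhW08.BurgersRate RhW08.BurgersRateG3 RhW08.TouchedDissipation RhW08.TouchedDissipationW
open RhIdea6.G17.W07C7 RhIdea6.G17.W07C7.Rev6 RhIdea6.G18.W07C8.Law421BirthS RhIdea6.G19.W07C11.Seam
open RhIdea6.G20.W07C12.Frac RhIdea6.G20.W07C12.StColP RhW07.C12.FieldSplit RhIdea6.G21.W07C13.TentMax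
open RhW07.C14.TwoSided RhW07.C14.Classes RhW07.C14.Lineage RhW07.C14.Booking
open RhW08.PurseP RhW08.TouchedGlueW RhW08.TouchedGlueH

/-! ## §L1 the LOOSE class -/

/-- §L1 **LOOSE level** (parameters: the dissipation constant `c`, the excluded class `𝓑`): an APPROACH level outside `𝓑` whose own signed-drop subsidy
does not exceed its unit charge (`4·dropQ j ≤ s`) and whose lowest pair dissipates `c·s²/η²` of Jensen energy across the level — F1's inequality on
the SAME `(j, j+1)` `lowH` pair.  A DEFINITION, not a law. -/
def LooseLevelQ (c : ℝ) (𝓑 : LevelClass) : LevelClass := fun η f x₀ s hmax R Hs B j =>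
  ApproachLevelQ η f x₀ s hmax R Hs B j ∧ ¬ 𝓑 η f x₀ s hmax R Hs B j ∧ 4 * dropQ η f x₀ s hmax R Hs B j ≤ s ∧
    c * s ^ 2 ≤ η ^ 2 * (lowH StTrkDQ η f x₀ s hmax R Hs B j ^ 2 - lowH StTrkDQ η f x₀ s hmax R Hs B (j + 1) ^ 2)

/-- §L1 the WIDENED far class `Far ∨ Loose`. -/
def FarLooseQ (c : ℝ) (𝓑 : LevelClass) : LevelClass := unionClass FarLevelQ (LooseLevelQ c 𝓑)

/-- (K) §L1 read-back: `FarLooseQ` is `Far ∨ Loose` (definitional). -/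
theorem farLooseQ_iff (c : ℝ) (𝓑 : LevelClass) (η : ℝ) (f : ℂ → ℂ) (x₀ s hmax R Hs : ℝ) (B j : ℕ) :
    FarLooseQ c 𝓑 η f x₀ s hmax R Hs B j ↔ FarLevelQ η f x₀ s hmax R Hs B j ∨ LooseLevelQ c 𝓑 η f x₀ s hmax R Hs B j :=
  Iff.rfl

/-- (K) §L1 the subsidy clause is AUTOMATIC at a charged level with a NON-EMPTY successor band: `4·dropQ j ≤ s` (every successor state is quarter-high,
`RhW08.BurgersRateG3.quarter_high_of_charged`).  It can fail only at a charged level whose successor band is EMPTY (`lowH (j+1) = sInf ∅ = 0`): such a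
level just fails Loose and stays in Ac′'s class (sound, crit-1 L5 shape). -/
theorem subsidy_of_charged_nonempty {η : ℝ} {f : ℂ → ℂ} {x₀ s hmax R Hs : ℝ} {B j : ℕ}
    (hch : Charged (PTrkSQ PBot) StTrkDQ ReadyR2 η f x₀ s hmax R Hs B j) (hne : ∃ u : ℂ, StTrkDQ η f x₀ s hmax R Hs B (j + 1) u) :
    4 * dropQ η f x₀ s hmax R Hs B j ≤ s := by
  obtain ⟨v, hlow, -, -⟩ := id hch
  obtain ⟨u, hu⟩ := hne
  have hLj : lowH StTrkDQ η f x₀ s hmax R Hs B j = v.im := lowH_eq_of_isLowest hlow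
  have hL1 : v.im - s / 4 ≤ lowH StTrkDQ η f x₀ s hmax R Hs B (j + 1) := by
    refine le_csInf ⟨|u.im|, ⟨u, hu, rfl⟩⟩ ?_
    rintro r ⟨u', hu', rfl⟩
    have hq := quarter_high_of_charged hch hlow hu'
    have hu0 : 0 < u'.im := hu'.2.2.1
    show v.im - s / 4 ≤ |u'.im|
    rw [abs_of_pos hu0]
    exact hq.le
  unfold dropQ
  rw [hLj]
  linarith

/-! ## §L2 the energy law ON A CLASS; F1′ ⟺ F1 -/

/-- §L2 the **c-SCALED ENERGY LAW ON A CLASS `𝓚`**: across a charged `𝓚`-level `c·s² ≤ η²·(lowH_j² − lowH_{j+1}²)` (F1's text with `FarLevelQ ↦ 𝓚`). -/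
def EnergyLawOnQ (𝓚 : LevelClass) (c : ℝ) : Prop :=
  ∀ (η : ℝ) (f : ℂ → ℂ) (x₀ s hmax R Hs : ℝ) (B : ℕ), EngineHyps5 2 η f x₀ s hmax R Hs B →
    ∀ j : ℕ, Charged (PTrkSQ PBot) StTrkDQ ReadyR2 η f x₀ s hmax R Hs B j → 𝓚 η f x₀ s hmax R Hs B j →
      c * s ^ 2 ≤ η ^ 2 * (lowH StTrkDQ η f x₀ s hmax R Hs B j ^ 2 - lowH StTrkDQ η f x₀ s hmax R Hs B (j + 1) ^ 2)

/-- (K) §L2 at the far class the law IS the registry's F1 `FarEnergyLawCQ c` (definitional). -/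
theorem energyLawOnQ_far_iff (c : ℝ) : EnergyLawOnQ FarLevelQ c ↔ FarEnergyLawCQ c :=
  Iff.rfl

/-- §L2 **F1′**: the far energy law over the WIDENED class `Far ∨ Loose`. -/
def FarLooseEnergyLawCQ (c : ℝ) (𝓑 : LevelClass) : Prop := EnergyLawOnQ (FarLooseQ c 𝓑) c

/-- ★ (K) §L2 **F1′ ⟺ F1** (both directions): far levels are F1's; a loose level carries the inequality in its definition. -/
theorem f1'_iff_f1 (c : ℝ) (𝓑 : LevelClass) : FarLooseEnergyLawCQ c 𝓑 ↔ FarEnergyLawCQ c := by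
  constructor
  · intro h η f x₀ s hmax R Hs B hE j hj hfar
    exact h η f x₀ s hmax R Hs B hE j hj (Or.inl hfar)
  · intro h η f x₀ s hmax R Hs B hE j hj hFL
    rcases hFL with hfar | hloose
    · exact h η f x₀ s hmax R Hs B hE j hj hfar
    · obtain ⟨_, _, _, hdis⟩ := hloose
      exact hdis

/-! ## §L3 the far TELESCOPE over an arbitrary class (verbatim `RhW08.SealSwapQ.farLawQ_of_energyLawC_rises`, `FarLevelQ ↦ 𝓚`) -/

/-- ★★ (K) §L3 **ENERGY LAW ON `𝓚` + RISE ALLOWANCE ⟹ CLASS LAW FOR `𝓚`** with the purse and the rise allowance scaled by `c⁻¹`: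
`EnergyLawOnQ 𝓚 c → EnergyRiseLawQ aR → ClassLawQ 𝓚 (c⁻¹·energyPurseQ + c⁻¹·aR)` (potential `η²·lowH²/(c·s²)`; proof = the tree's, verbatim). -/
theorem classLawQ_of_energyLawOn_rises {𝓚 : LevelClass} {c : ℝ} {aR : Budget} (hc : 0 < c) (hR2 : EnergyLawOnQ 𝓚 c)
    (hr : EnergyRiseLawQ aR) : ClassLawQ 𝓚 (addBudget (scaleBudgetQ c⁻¹ energyPurseQ) (scaleBudgetQ c⁻¹ aR)) := by
  have hci : 0 ≤ c⁻¹ := inv_nonneg.mpr hc.le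
  refine classLawQ_of_potential_rises
    (fun η f x₀ s hmax R Hs B k => c⁻¹ * (η ^ 2 * lowH StTrkDQ η f x₀ s hmax R Hs B k ^ 2 / s ^ 2))
    (fun η f x₀ s hmax R Hs B j => c⁻¹ *
      max (η ^ 2 * lowH StTrkDQ η f x₀ s hmax R Hs B (j + 1) ^ 2 / s ^ 2 - η ^ 2 * lowH StTrkDQ η f x₀ s hmax R Hs B j ^ 2 / s ^ 2) 0) ?_
  intro η f x₀ s hmax R Hs B hE
  have hs : 0 < s := hE.2.2.2.1
  have hs2 : 0 < s ^ 2 := by positivity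
  refine ⟨fun k => by positivity, le_of_eq rfl, fun k hk => ?_, ?_⟩
  · rw [prefixSumQ_const_mul]
    exact mul_le_mul_of_nonneg_left (hr η f x₀ s hmax R Hs B hE k hk) hci
  intro k _
  have hmx := le_max_left (η ^ 2 * lowH StTrkDQ η f x₀ s hmax R Hs B (k + 1) ^ 2 / s ^ 2
      - η ^ 2 * lowH StTrkDQ η f x₀ s hmax R Hs B k ^ 2 / s ^ 2) 0
  have hρ0 : 0 ≤ c⁻¹ * max (η ^ 2 * lowH StTrkDQ η f x₀ s hmax R Hs B (k + 1) ^ 2 / s ^ 2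
      - η ^ 2 * lowH StTrkDQ η f x₀ s hmax R Hs B k ^ 2 / s ^ 2) 0 := mul_nonneg hci (le_trans (le_refl _) (le_max_right _ _))
  have hlin : c⁻¹ * (η ^ 2 * lowH StTrkDQ η f x₀ s hmax R Hs B (k + 1) ^ 2 / s ^ 2)
      - c⁻¹ * (η ^ 2 * lowH StTrkDQ η f x₀ s hmax R Hs B k ^ 2 / s ^ 2)
      ≤ c⁻¹ * max (η ^ 2 * lowH StTrkDQ η f x₀ s hmax R Hs B (k + 1) ^ 2 / s ^ 2
          - η ^ 2 * lowH StTrkDQ η f x₀ s hmax R Hs B k ^ 2 / s ^ 2) 0 := by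
    rw [← mul_sub]; exact mul_le_mul_of_nonneg_left hmx hci
  by_cases hj : Charged (PTrkSQ PBot) StTrkDQ ReadyR2 η f x₀ s hmax R Hs B k ∧ 𝓚 η f x₀ s hmax R Hs B k
  · rw [if_pos hj]
    have hE2 := hR2 η f x₀ s hmax R Hs B hE k hj.1 hj.2
    have hl0 : 0 ≤ lowH StTrkDQ η f x₀ s hmax R Hs B k := RhW08.StSwap.lowH_nonneg _ _ _ _ _ _ _ _ _ _
    have hl1 : 0 ≤ lowH StTrkDQ η f x₀ s hmax R Hs B (k + 1) := RhW08.StSwap.lowH_nonneg _ _ _ _ _ _ _ _ _ _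
    have hcs : 0 < c * s ^ 2 := mul_pos hc hs2
    have hEd : lowH StTrkDQ η f x₀ s hmax R Hs B (k + 1) ^ 2 < lowH StTrkDQ η f x₀ s hmax R Hs B k ^ 2 := by
      have hη : 0 ≤ η ^ 2 := sq_nonneg η
      by_contra hle
      rw [not_lt] at hle
      have : η ^ 2 * (lowH StTrkDQ η f x₀ s hmax R Hs B k ^ 2 - lowH StTrkDQ η f x₀ s hmax R Hs B (k + 1) ^ 2) ≤ 0 :=
        mul_nonpos_of_nonneg_of_nonpos hη (by linarith)
      linarith
    have hld : lowH StTrkDQ η f x₀ s hmax R Hs B (k + 1) < lowH StTrkDQ η f x₀ s hmax R Hs B k :=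
      lt_of_pow_lt_pow_left₀ 2 hl0 hEd
    have hd : 0 ≤ 4 * dropQ η f x₀ s hmax R Hs B k / s := div_nonneg (by unfold dropQ; linarith) hs.le
    have key : 1 ≤ c⁻¹ * (η ^ 2 * (lowH StTrkDQ η f x₀ s hmax R Hs B k ^ 2 - lowH StTrkDQ η f x₀ s hmax R Hs B (k + 1) ^ 2) / s ^ 2) := by
      rw [inv_mul_eq_div, le_div_iff₀ hc, one_mul, le_div_iff₀ hs2]
      exact hE2
    have hre : c⁻¹ * (η ^ 2 * lowH StTrkDQ η f x₀ s hmax R Hs B k ^ 2 / s ^ 2)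
        - c⁻¹ * (η ^ 2 * lowH StTrkDQ η f x₀ s hmax R Hs B (k + 1) ^ 2 / s ^ 2)
        = c⁻¹ * (η ^ 2 * (lowH StTrkDQ η f x₀ s hmax R Hs B k ^ 2 - lowH StTrkDQ η f x₀ s hmax R Hs B (k + 1) ^ 2) / s ^ 2) := by
      ring
    linarith
  · rw [if_neg hj, add_zero]
    linarith

/-- ★★ (K) §L3 **THE WIDENED TELESCOPE**: F1 + rise allowance ⟹ a class law for `Far ∨ Loose` against the SAME purse `c⁻¹·energyPurseQ + c⁻¹·aR`
(no second copy of Π_far: one potential `η²·lowH²/(c·s²)`, each charged level of the class consumes ≥ 1 unit of it, once). -/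
theorem farLooseLawQ_of_far_rises {c : ℝ} (𝓑 : LevelClass) {aR : Budget} (hc : 0 < c) (hR2 : FarEnergyLawCQ c) (hr : EnergyRiseLawQ aR) :
    ClassLawQ (FarLooseQ c 𝓑) (addBudget (scaleBudgetQ c⁻¹ energyPurseQ) (scaleBudgetQ c⁻¹ aR)) :=
  classLawQ_of_energyLawOn_rises hc ((f1'_iff_f1 c 𝓑).2 hR2) hr

/-! ## §L4 Ac′ and ★A ⟹ Ac′ -/

/-- §L4 **Ac′ — THE RE-CUT APPROACH ALLOWANCE**: the charged levels of `Approach ∧ ¬Loose`, net of their own signed drops, cost at most `aA`. -/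
def ApproachRecutAllowanceQ (c : ℝ) (𝓑 : LevelClass) (aA : Budget) : Prop :=
  ClassLawQ (diffClass ApproachLevelQ (LooseLevelQ c 𝓑)) aA

/-- (K) §L4 the books cost of the LOOSE class is non-negative at every prefix (the subsidy clause `4·dropQ ≤ s` makes each summand `1 − 4·dropQ/s ≥ 0`). -/
theorem netCostQ_loose_nonneg (c : ℝ) (𝓑 : LevelClass) {η : ℝ} {f : ℂ → ℂ} {x₀ s hmax R Hs : ℝ} {B : ℕ} (hs : 0 < s) (k : ℕ) :
    0 ≤ netCostQ (LooseLevelQ c 𝓑) η f x₀ s hmax R Hs B k := by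
  unfold netCostQ
  refine Finset.sum_nonneg fun j _ => ?_
  split_ifs with h
  · obtain ⟨_, _, hsub, _⟩ := h.2
    rw [sub_nonneg, div_le_one hs]
    exact hsub
  · exact le_rfl

/-- (K) §L4 `Loose ∪ Approach = Approach` (Loose ⊆ Approach by definition). -/
theorem unionClass_loose_approach (c : ℝ) (𝓑 : LevelClass) : unionClass (LooseLevelQ c 𝓑) ApproachLevelQ = ApproachLevelQ := by
  funext η f x₀ s hmax R Hs B j
  exact propext ⟨fun h => h.elim (fun hl => hl.1) id, fun h => Or.inr h⟩

/-- (K) §L4 ★A's class cost SPLITS as loose + re-cut (summand-wise). -/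
theorem netCostQ_approach_split (c : ℝ) (𝓑 : LevelClass) (η : ℝ) (f : ℂ → ℂ) (x₀ s hmax R Hs : ℝ) (B k : ℕ) :
    netCostQ ApproachLevelQ η f x₀ s hmax R Hs B k
      = netCostQ (LooseLevelQ c 𝓑) η f x₀ s hmax R Hs B k + netCostQ (diffClass ApproachLevelQ (LooseLevelQ c 𝓑)) η f x₀ s hmax R Hs B k := by
  have h := netCostQ_union (LooseLevelQ c 𝓑) ApproachLevelQ η f x₀ s hmax R Hs B k
  rw [unionClass_loose_approach] at h
  exact h

/-- ★ (K) §L4 **★A ⟹ Ac′** (crit-1 L4: benches transfer; v12q is never harder than v11q): removing the loose levels never raises the class cost. -/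
theorem ac'_of_starA (c : ℝ) (𝓑 : LevelClass) {aA : Budget} (h : ApproachAllowanceQ aA) : ApproachRecutAllowanceQ c 𝓑 aA := by
  intro η f x₀ s hmax R Hs B hE k hk
  have hs : 0 < s := hE.2.2.2.1
  have h1 := h η f x₀ s hmax R Hs B hE k hk
  have h2 := netCostQ_approach_split c 𝓑 η f x₀ s hmax R Hs B (k + 1)
  have h3 := netCostQ_loose_nonneg c 𝓑 (η := η) (f := f) (x₀ := x₀) (hmax := hmax) (R := R) (Hs := Hs) (B := B) hs (k + 1)
  show netCostQ (diffClass ApproachLevelQ (LooseLevelQ c 𝓑)) η f x₀ s hmax R Hs B (k + 1) ≤ aA η f x₀ s hmax R Hs B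
  have h1' : netCostQ ApproachLevelQ η f x₀ s hmax R Hs B (k + 1) ≤ aA η f x₀ s hmax R Hs B := h1
  linarith

/-- (K) §L4 Ac′ is ANTITONE in the excluded class: enlarging `𝓑` shrinks Loose, so `Ac′(𝓑') ⟹ Ac′(𝓑)` for `𝓑 ⊆ 𝓑'`; in particular every instance implies the
κ₀-free one `𝓑 := NoLevelsQ`. -/
theorem ac'_antitone {c : ℝ} {𝓑 𝓑' : LevelClass} {aA : Budget}
    (hsub : ∀ (η : ℝ) (f : ℂ → ℂ) (x₀ s hmax R Hs : ℝ) (B j : ℕ), 𝓑 η f x₀ s hmax R Hs B j → 𝓑' η f x₀ s hmax R Hs B j)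
    (h : ApproachRecutAllowanceQ c 𝓑' aA) : ApproachRecutAllowanceQ c 𝓑 aA := by
  intro η f x₀ s hmax R Hs B hE k hk
  have hs : 0 < s := hE.2.2.2.1
  have h1 : netCostQ (diffClass ApproachLevelQ (LooseLevelQ c 𝓑')) η f x₀ s hmax R Hs B (k + 1) ≤ aA η f x₀ s hmax R Hs B :=
    h η f x₀ s hmax R Hs B hE k hk
  -- the 𝓑'-re-cut class = the 𝓑-re-cut class ∪ (loose for 𝓑 but inside 𝓑'), and the second part has non-negative summands
  have hU : unionClass (diffClass ApproachLevelQ (LooseLevelQ c 𝓑)) (diffClass ApproachLevelQ (LooseLevelQ c 𝓑'))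
      = diffClass ApproachLevelQ (LooseLevelQ c 𝓑') := by
    funext η f x₀ s hmax R Hs B j
    refine propext ⟨fun hx => hx.elim (fun hl => ⟨hl.1, fun hL => hl.2 ⟨hL.1, fun hb => hL.2.1 (hsub _ _ _ _ _ _ _ _ _ hb), hL.2.2⟩⟩) id,
      fun hx => Or.inr hx⟩
  have h2 := netCostQ_union (diffClass ApproachLevelQ (LooseLevelQ c 𝓑)) (diffClass ApproachLevelQ (LooseLevelQ c 𝓑')) η f x₀ s hmax R Hs B (k + 1)
  rw [hU] at h2
  have h3 : 0 ≤ netCostQ (diffClass (diffClass ApproachLevelQ (LooseLevelQ c 𝓑')) (diffClass ApproachLevelQ (LooseLevelQ c 𝓑)))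
      η f x₀ s hmax R Hs B (k + 1) := by
    unfold netCostQ
    refine Finset.sum_nonneg fun j _ => ?_
    split_ifs with hx
    · obtain ⟨_, ⟨hA, hnL'⟩, hnot⟩ := hx
      have hL : LooseLevelQ c 𝓑 η f x₀ s hmax R Hs B j := by
        by_contra hL
        exact hnot ⟨hA, hL⟩
      obtain ⟨_, _, hsub', _⟩ := hL
      rw [sub_nonneg, div_le_one hs]
      exact hsub'
    · exact le_rfl
  show netCostQ (diffClass ApproachLevelQ (LooseLevelQ c 𝓑)) η f x₀ s hmax R Hs B (k + 1) ≤ aA η f x₀ s hmax R Hs B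
  linarith

/-! ## §L5 the three books at the widened far class; the RATE door at the ½ purse -/

/-- (K) §L5 the consumption class is unchanged by the re-cut: `Cons ∖ (Far ∨ Loose) ⟺ Cons ∖ Far` (a loose level is an approach level, hence not Cons). -/
theorem consDiff_farLoose_iff (c : ℝ) (𝓑 : LevelClass) (η : ℝ) (f : ℂ → ℂ) (x₀ s hmax R Hs : ℝ) (B j : ℕ) :
    diffClass ConsLevelQ (FarLooseQ c 𝓑) η f x₀ s hmax R Hs B j ↔ diffClass ConsLevelQ FarLevelQ η f x₀ s hmax R Hs B j := by
  simp only [diffClass, FarLooseQ, unionClass, LooseLevelQ, ApproachLevelQ, restClass]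
  tauto

/-- (K) §L5 the rest class of the re-cut partition IS Ac′'s class: `rest(Far ∨ Loose, Cons) ⟺ Approach ∧ ¬Loose`. -/
theorem rest_farLoose_iff (c : ℝ) (𝓑 : LevelClass) (η : ℝ) (f : ℂ → ℂ) (x₀ s hmax R Hs : ℝ) (B j : ℕ) :
    restClass (FarLooseQ c 𝓑) ConsLevelQ η f x₀ s hmax R Hs B j ↔ diffClass ApproachLevelQ (LooseLevelQ c 𝓑) η f x₀ s hmax R Hs B j := by
  simp only [diffClass, FarLooseQ, unionClass, restClass, ApproachLevelQ]
  tauto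

/-- (K) §L5 the CAPITAL identity at the ½ purse with ★A's allowance literal UNCHANGED: far purse `(4/5)⁻¹·energyPurseQ + (4/5)⁻¹·aR` (ONE copy), `aC`,
and `approachBudgetHalfQ aR aC` fit `slackPQ halfPurse` exactly (`capitalLawPQ_residual` + `residualBudgetPQ_halfPurse`). -/
theorem capitalLawPQ_half_recut (aR aC : Budget) :
    CapitalLawPQ halfPurse (addBudget (scaleBudgetQ (4 / 5)⁻¹ energyPurseQ) (scaleBudgetQ (4 / 5)⁻¹ aR)) aC (approachBudgetHalfQ aR aC) := by
  have h := capitalLawPQ_residual halfPurse (addBudget (scaleBudgetQ (4 / 5)⁻¹ energyPurseQ) (scaleBudgetQ (4 / 5)⁻¹ aR)) aC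
  rw [residualBudgetPQ_halfPurse] at h
  exact h

/-- ★★ (K) §L5 **THE RE-CUT RATE DOOR at the ½ purse**: F1 `FarEnergyLawCQ (4/5)` + F2 `EnergyRiseLawQ aR` + C `ConsLawQ aC` + Ac′ at ★A's allowance
`approachBudgetHalfQ aR aC` ⟹ `RestRateBotPQ halfPurse` (three books `restRateBotPQ_of_threeBooks_ge` with far class `Far ∨ Loose`). -/
theorem restRateBotPQ_half_of_recut (𝓑 : LevelClass) {aR aC : Budget} (hR2 : FarEnergyLawCQ (4 / 5)) (hr : EnergyRiseLawQ aR) (hC : ConsLawQ aC)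
    (hA : ApproachRecutAllowanceQ (4 / 5) 𝓑 (approachBudgetHalfQ aR aC)) : RestRateBotPQ halfPurse :=
  restRateBotPQ_of_threeBooks_ge (𝓕 := FarLooseQ (4 / 5) 𝓑) (𝓒 := ConsLevelQ) hP_half
    (farLooseLawQ_of_far_rises 𝓑 (by norm_num) hR2 hr)
    (creditLawQ_congr (fun η f x₀ s hmax R Hs B j => (consDiff_farLoose_iff (4 / 5) 𝓑 η f x₀ s hmax R Hs B j).symm) hC)
    (classLawQ_congr (fun η f x₀ s hmax R Hs B j => (rest_farLoose_iff (4 / 5) 𝓑 η f x₀ s hmax R Hs B j).symm) hA)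
    (capitalLawPQ_half_recut aR aC)

/-! ## §L6 Γ-side glue re-targeted to Ac′ -/

/-- (K) §L6 Ac′'s class REASSEMBLED: a β class law and a law Γ4′ for `(Approach ∧ ¬Loose) ∖ β` give Ac′ at `aβ + aRest` — for the instance `𝓑 := BetaLevelQ κ₀`
(β ⊆ Approach ∧ ¬Loose by the two definitions). -/
theorem approachRecut_of_beta_rest {c κ₀ : ℝ} {aβ aRest : Budget} (hβ : ClassLawQ (BetaLevelQ κ₀) aβ)
    (hrest : ClassLawQ (diffClass (diffClass ApproachLevelQ (LooseLevelQ c (BetaLevelQ κ₀))) (BetaLevelQ κ₀)) aRest) :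
    ApproachRecutAllowanceQ c (BetaLevelQ κ₀) (addBudget aβ aRest) := by
  have hU := classLawQ_union hβ hrest
  refine classLawQ_congr (fun η f x₀ s hmax R Hs B j => ?_) hU
  have hβA : BetaLevelQ κ₀ η f x₀ s hmax R Hs B j → ApproachLevelQ η f x₀ s hmax R Hs B j := fun hb => hb.1
  have hβL : BetaLevelQ κ₀ η f x₀ s hmax R Hs B j → ¬ LooseLevelQ c (BetaLevelQ κ₀) η f x₀ s hmax R Hs B j :=
    fun hb hL => hL.2.1 hb
  simp only [unionClass, diffClass]
  tauto

/-- ★★ (K, modulo the NAMED hypotheses) §L6 **THE GLUE re-targeted (rev 8 draft)**: #1205's binders — W(cF) with `cF > 0` on legal frames, (Γ3″) rise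
allowance — + (Γ4′) the rest of the RE-CUT class + FIT ⟹ Ac′ at `approachBudgetHalfQ aR aC` (FIT_W shape; the FIT″ variant replaces `betaClassLaw_of_TH …`
by 41e's `classLawQ_betaUsed (betaClassLaw_of_TH …)` verbatim once RSV-62 is in the tree). -/
theorem approachRecut_of_TH {cF : Budget} {L κ₀ c : ℝ} {aT aRest aR aC : Budget}
    (hcF : ∀ (η : ℝ) (f : ℂ → ℂ) (x₀ s hmax R Hs : ℝ) (B : ℕ), EngineHyps5 2 η f x₀ s hmax R Hs B → 0 < cF η f x₀ s hmax R Hs B)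
    (hL : 0 ≤ L) (hT : TouchedDissipationLawWQ cF L κ₀) (hrise : TouchRiseLawHQ cF L κ₀ aT)
    (hrest : ClassLawQ (diffClass (diffClass ApproachLevelQ (LooseLevelQ c (BetaLevelQ κ₀))) (BetaLevelQ κ₀)) aRest)
    (hfit : ∀ (η : ℝ) (f : ℂ → ℂ) (x₀ s hmax R Hs : ℝ) (B : ℕ), EngineHyps5 2 η f x₀ s hmax R Hs B →
      betaPurseWQ cF L η f x₀ s hmax R Hs B + aT η f x₀ s hmax R Hs B + aRest η f x₀ s hmax R Hs B
        ≤ approachBudgetHalfQ aR aC η f x₀ s hmax R Hs B) :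
    ApproachRecutAllowanceQ c (BetaLevelQ κ₀) (approachBudgetHalfQ aR aC) :=
  classLawQ_mono (approachRecut_of_beta_rest (betaClassLaw_of_TH hcF hL hT hrise) hrest)
    (fun η f x₀ s hmax R Hs B hE => by
      show betaPurseWQ cF L η f x₀ s hmax R Hs B + aT η f x₀ s hmax R Hs B + aRest η f x₀ s hmax R Hs B ≤ _
      exact hfit η f x₀ s hmax R Hs B hE)

/-! ## §L7 the crux BY NAME from the re-cut stub set -/

/-- ★★★ (K) §L7 **THE v12q COMPOSITION** (generic in the excluded class `𝓑`): TopPinning + RegUmbrella11S (SUCC, v11q's) + F1 + F2c + Cc + Ac′ ⟹ the crux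
`TiltedLandingLaw421R` BY NAME (`law421Half_of_succ_rate` ∘ `restSuccBotQ_of_resS` ∘ `regRes8S_of_regHungCut10S` ∘ `regHungCut10S_of_topPinning`, and §L5). -/
theorem law421R_of_recut (𝓑 : LevelClass) (hP : RhW08.Lens1Pinning.TopPinning) (hU : RhW08.Lens1Pinning.RegUmbrella11S)
    (hR2 : FarEnergyLawCQ (4 / 5)) (hr : EnergyRiseLawQ riseSupQ) (hC : ConsLawQ consSupQ)
    (hA : ApproachRecutAllowanceQ (4 / 5) 𝓑 (approachBudgetHalfQ riseSupQ consSupQ)) :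
    Summit.RiemannHypothesis.RiemannHypothesis.Theses.EarlyAppointments.TiltedLandingLaw421R :=
  law421Half_of_succ_rate
    (RhW08.Lens1Coverage.restSuccBotQ_of_resS
      (RhW08.Lens1Coverage.regRes8S_of_regHungCut10S (RhW08.Lens1Pinning.regHungCut10S_of_topPinning hP hU)))
    (restRateBotPQ_half_of_recut 𝓑 hR2 hr hC hA)

end RhW08.LooseRecut
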